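/-
Origin: expansion seat `planner-pub-hodgecm-mc-axioms-1-g14-0`, handover #W207 2026-08-20T15:53:55Z md5 e92da2c9d5db (PKG 38c3cbe766eb → e92da2c9d5db; 216 l.; MECHANICAL (iib-R) rewrite v3.1 of the PKG file as it stands (88 token edits; rules R1x1+RX[h₂]x87)) (`HOME/mc/pub-hodgecm-mc-axioms-1-g14/revendor/kit-r55/stage55/HodgeCM/Model/Binders/Real34PinsTotalKA.lean`, md5 e92da2c9d5db, 216 lines);
landed by the gen-22 packager (p-g22) in gate run 55 REPLACES the earlier landed copy of `HodgeCM/Model/Binders/Real34PinsTotalKA.lean` (seat copy carried the packager Origin header of an earlier run (stripped)).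
-/
/-
Origin: speedrun cell pub-hodgecm, MODEL-CONSTRUCTION sub-cell, unit pub-hodgecm-mc-binder-1-g10 (BINDER PROVER, gen 10; node B2-meet,
BINDER-OWNERS row 15 `real34` at the TOTAL pins of record — RUN-38-world step), seat prover-pub-hodgecm-mc-binder-1-g10-0, 2026-08-20.
Target in PKG: HodgeCM/Model/Binders/Real34PinsTotalKA.lean (NEW additive leaf, RUN 39+; imports #28 `Binders/Real34PinsTotalK` and theta-3's (E1)
`Model/ArchLineInputOf` (RUN 38); needs theta-3's RUN-38 WHOLE-FILE REPLACEMENT (A) `Model/ThetaSpaceInputPin` 68c7c57560c1 — structure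
`ThetaAdelicSide` with the (L3)/(L3b) pin fields and the pin lemma `ThetaAdelicSide.exists_corrector_of_mem_levelImage`).
KERNEL ONLY: 0 records of published theorems, nothing cited, 0 `def … : Prop`, MODEL-N ±0, E unchanged.
Nothing here is a claim of the manuscripts under adjudication.
-/
import Summits.HodgeConjecture.HodgeCM.Model.Binders.Real34PinsTotalK_2
import Summits.HodgeConjecture.HodgeCM.Model.ArchLineInputOf

/-!
# Row `real34` at the total pins of record, RUN-38 world: the residual is the K-type datum ALONE

With theta-3's (A) `Model/ThetaSpaceInputPin` r38 the (L3) hypothesis `hcorr` of #28 `Gen12Pins.real34_totalKE` is a PIN FIELD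
(`ThetaAdelicSide.rat_split_level`, read through `ThetaAdelicSide.exists_corrector_of_mem_levelImage`) of EVERY `ThetaAdelicSide`, in
particular of `(SInstance.S …) V c` — **`Gen12Pins.hcorr_total`** (no guard); and at the `A`-slot pin of record
`A := fun V c k => archLineInputOf (𝔄 V c) k` (theta-3 (E1)) the line-weight read-back `hAw` is `rfl` for every `k` — **`hAw_archLine`**
(cf. #27 `hN1g_archLine`).  Hence **`Gen12Pins.real34_totalKA 𝔄`** / **`real34_totalKAE 𝔄`**: E's binder `real34` VERBATIM at the pins of
record from E's own `hpc hcup hph h31 hLiu` and ONE `Real34KTypeDatum` per good sextic context — nothing else; and the density-free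
twins **`real34_totalKTA`** / **`real34_totalKTAE`** over ONE character-wise `Real34KTypeDatumT` per good sextic context.
-/

set_option autoImplicit false

noncomputable section

open MeasureTheory NumberField MulAction
open scoped Matrix InnerProductSpace

namespace HodgeCM.Model

open HodgeCM HodgeCM.Universe HodgeCM.Adelic
open Literature.NumberTheory.Weil1964
open Literature.NumberTheory.Automorphic (piSchwartzBruhat)
open Literature.NumberTheory.Automorphic.UnitaryGroup (archIsotropy archIsotropyProj archKappa archSectionU21CM)
open Literature.NumberTheory.GelbartRogawski1991.UnitaryDualPair
open Literature.RepresentationTheory.HeisenbergGroup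
open Literature.Geometry.ComplexHyperbolic.BallModel (U21 x₀ Jac)
open Literature.AlgebraicGeometry.HodgeTheory
open Literature.NumberTheory.Automorphic.PicardCM
open Literature.NumberTheory.Transcendental (Arapura2012_Cor_15_4_6)
open HodgeCM.CMTypeOps (inflate)
open HodgeCM.Model.ThetaSpace
open HodgeCM.Model.ArchSideTerm

namespace Gen12Pins

variable
  (hGR : ∀ {L : CMField} {ι₁ : L →+* ℂ} (V : HermSpace3 L ι₁) (c : SeesawCtx L),
    (cmSplittingDatum (L : Type) finProdFinEquiv (frameD V) (frameD_real V) (frameD_ne V) (dW c.D) (dW_real c.D)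
      (dW_ne c.D)).CompatibleSplitting)
  (η : ∀ {L : CMField} {ι₁ : L →+* ℂ} (V : HermSpace3 L ι₁) (c : SeesawCtx L),
    CMAdelic (L : Type) (frameD V) × CMAdelic (L : Type) (dW c.D) →* ℂˣ)
  (hη : ∀ {L : CMField} {ι₁ : L →+* ℂ} (V : HermSpace3 L ι₁) (c : SeesawCtx L),
    ∀ γU ∈ CMRat (L : Type) (frameD V), ∀ γ ∈ CMRat (L : Type) (dW c.D), η V c (γU, γ) = 1)
  (hηc : ∀ {L : CMField} {ι₁ : L →+* ℂ} (V : HermSpace3 L ι₁) (c : SeesawCtx L), Continuous fun p => ((η V c p : ℂˣ) : ℂ))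
  (hGR₀ : ∀ {L : CMField} {ι₁ : L →+* ℂ} (V : HermSpace3 L ι₁) (c : SeesawCtx L),
    (cmSplittingDatum (L : Type) (e₁) (frameD V) (frameD_real V) (frameD_ne V) (lineVec (L : Type) (dW c.D 0))
      (fun _ => dW_real c.D 0) (fun _ => dW_ne c.D 0)).CompatibleSplitting)
  (hGR₁ : ∀ {L : CMField} {ι₁ : L →+* ℂ} (V : HermSpace3 L ι₁) (c : SeesawCtx L),
    (cmSplittingDatum (L : Type) (e₁) (frameD V) (frameD_real V) (frameD_ne V) (lineVec (L : Type) (dW c.D 1))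
      (fun _ => dW_real c.D 1) (fun _ => dW_ne c.D 1)).CompatibleSplitting)
  (hGR₂ : ∀ {L : CMField} {ι₁ : L →+* ℂ} (V : HermSpace3 L ι₁) (c : SeesawCtx L),
    (cmSplittingDatum (L : Type) (e₁) (frameD V) (frameD_real V) (frameD_ne V) (lineVec (L : Type) (dW' c.D 0))
      (fun _ => dW'_real c.D 0) (fun _ => dW'_ne c.D 0)).CompatibleSplitting)
  (hGR₃ : ∀ {L : CMField} {ι₁ : L →+* ℂ} (V : HermSpace3 L ι₁) (c : SeesawCtx L),
    (cmSplittingDatum (L : Type) (e₁) (frameD V) (frameD_real V) (frameD_ne V) (lineVec (L : Type) (dW' c.D 1))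
      (fun _ => dW'_real c.D 1) (fun _ => dW'_ne c.D 1)).CompatibleSplitting)
  (A : ∀ {L : CMField} {ι₁ : L →+* ℂ} (V : HermSpace3 L ι₁) (c : SeesawCtx L) (k : Fin 4),
    ArchLineInput V (lineRepD V c.D (hGR V c) (hGR₀ V c) (hGR₁ V c) (hGR₂ V c) (hGR₃ V c) (η V c) k))

variable (hHD : exists_isReal_hodgeModel) (hI : hodgePQ_independent_of_hodgeModel)
  (h₁ : BallQuotientUniformised)  (h₃ : CMAbelianVarietyRealised)
  (h : Bool) (hA : Arapura2012_Cor_15_4_6) (μ : ∀ {L : CMField}, SeesawCtx L → Fin 4 → InfinitePlace L → ℤ)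

/-! ## 1. (L3) at the total pins, discharged by theta-3's pin field -/

/-- **(L3) `hcorr` at the total pins, DISCHARGED** (theta-3 (A) r38: pin field `ThetaAdelicSide.rat_split_level` through
`ThetaAdelicSide.exists_corrector_of_mem_levelImage`; holds for EVERY `ThetaAdelicSide`, no guard). -/
theorem hcorr_total {L : CMField} {ι₁ : L →+* ℂ} (V : HermSpace3 L ι₁) (c : SeesawCtx L) (hV : IsAnisotropic L V.Hm) :
    ∀ (Γ : Level V), ∀ δ ∈ levelImage hHD hI h₁ h₃ Γ hV,
      ∃ x : (V.latticeModel printFact_unitaryCompact_holds).G, x ∈ satLevelRegimeOf V hV Γ.K ∧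
        ((SInstance.S @hGR @η @hη @hηc @hGR₀ @hGR₁ @hGR₂ @hGR₃ @A) V c).ιinf δ * x ∈ (V.latticeModel printFact_unitaryCompact_holds).Γ ∧
          ∀ y : U21, Commute x (((SInstance.S @hGR @η @hη @hηc @hGR₀ @hGR₁ @hGR₂ @hGR₃ @A) V c).ιinf y) :=
  fun Γ => ((SInstance.S @hGR @η @hη @hηc @hGR₀ @hGR₁ @hGR₂ @hGR₃ @A) V c).exists_corrector_of_mem_levelImage hHD hI h₁ h₃ Γ hV

/-! ## 2. The line-weight read-back at the (E1) pin, and the headline -/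

variable (𝔄 : ∀ {L : CMField} {ι₁ : L →+* ℂ} (V : HermSpace3 L ι₁) (c : SeesawCtx L),
    ArchLineDatum V c.D (hGR V c) (hGR₀ V c) (hGR₁ V c) (hGR₂ V c) (hGR₃ V c) (η V c) (μ c))

/-- **`hAw` at the `A` pin of record is `rfl`** (theta-3 (E1) `archLineInputOf_w_apply`, every `k`; the guard and `k ∈ {2,3}` unused). -/
theorem hAw_archLine :
    ∀ {L : CMField} {ι₁ : L →+* ℂ} (V : HermSpace3 L ι₁) (c : SeesawCtx L),
      (pinT hHD hI h₁ h₃ h hA (Wg @hGR @η @hη @hηc @τSyl @TSyl @hTSyl)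
          (SInstance.S @hGR @η @hη @hηc @hGR₀ @hGR₁ @hGR₂ @hGR₃ (fun V c k => archLineInputOf (𝔄 V c) k)) μ).GoodCtx ι₁ c →
        ∀ k : Fin 4, k = 2 ∨ k = 3 → (archLineInputOf (𝔄 V c) k).w = ⇑(archWeight L (μ c k)) :=
  fun _ _ _ _ _ => rfl

/-- **Row 15 (`real34`) at the pins of record from the K-type datum ALONE** (quantified `pinT` form): #28 `real34_totalK` at
`A := fun V c k => archLineInputOf (𝔄 V c) k` with `hAw := hAw_archLine`, `hcorr := hcorr_total`. -/
theorem real34_totalKA (hpc : (picardCMUniverse hHD hI h₁ h₃).Fact_pull_comp)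
    (hcup : (picardCMUniverse hHD hI h₁ h₃).Fact_pull_cup) (hph : (picardCMUniverse hHD hI h₁ h₃).Fact_pull_hodge)
    (h31 : (picardCMUniverse hHD hI h₁ h₃).Fact_cmInflation)
    (hLiu : ∀ {L : CMField} {ι₁ : L →+* ℂ} (V : HermSpace3 L ι₁) (c : SeesawCtx L),
      (pinT hHD hI h₁ h₃ h hA (Wg @hGR @η @hη @hηc @τSyl @TSyl @hTSyl) (SInstance.S @hGR @η @hη @hηc @hGR₀ @hGR₁ @hGR₂ @hGR₃ (fun V c k => archLineInputOf (𝔄 V c) k)) μ).GoodCtx ι₁ c → Module.finrank ℚ c.K = 6 →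
      ∀ (i : Fin 4) (Γ : Level V), ∃ (M : CMField) (k : c.K →+* M) (σ' : M →+* ℂ), σ'.comp k = c.σ ∧
        (pinT hHD hI h₁ h₃ h hA (Wg @hGR @η @hη @hηc @τSyl @TSyl @hTSyl) (SInstance.S @hGR @η @hη @hηc @hGR₀ @hGR₁ @hGR₂ @hGR₃ (fun V c k => archLineInputOf (𝔄 V c) k)) μ).Theta V c i Γ ⊆
          (picardCMUniverse hHD hI h₁ h₃).Uiso Γ M (inflate k (c.Ψ i)) σ')
    (D : ∀ {L : CMField} {ι₁ : L →+* ℂ} (V : HermSpace3 L ι₁) (c : SeesawCtx L) (hV : IsAnisotropic L V.Hm)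
      (hc : (pinT hHD hI h₁ h₃ h hA (Wg @hGR @η @hη @hηc @τSyl @TSyl @hTSyl) (SInstance.S @hGR @η @hη @hηc @hGR₀ @hGR₁ @hGR₂ @hGR₃ (fun V c k => archLineInputOf (𝔄 V c) k)) μ).GoodCtx ι₁ c), Module.finrank ℚ c.K = 6 →
        Real34KTypeDatum hHD hI h₁ h₃ h hA (Wg @hGR @η @hη @hηc @τSyl @TSyl @hTSyl) (SInstance.S @hGR @η @hη @hηc @hGR₀ @hGR₁ @hGR₂ @hGR₃ (fun V c k => archLineInputOf (𝔄 V c) k)) μ V c hV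
          (SeesawHyp34.ofTotal @hGR @η @hη @hηc @hGR₀ @hGR₁ @hGR₂ @hGR₃ (fun V c k => archLineInputOf (𝔄 V c) k) V c
            (planeDefinite_of_goodCtx @hGR @η @hη @hηc @hGR₀ @hGR₁ @hGR₂ @hGR₃ (fun V c k => archLineInputOf (𝔄 V c) k) hHD hI h₁ h₃ h hA @μ c hc))
          (adm₃₄ hHD hI h₁ h₃ ((SInstance.S @hGR @η @hη @hηc @hGR₀ @hGR₁ @hGR₂ @hGR₃ (fun V c k => archLineInputOf (𝔄 V c) k)) V c) hV))
    {L : CMField} {ι₁ : L →+* ℂ} (V : HermSpace3 L ι₁) (c : SeesawCtx L)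
    (hc : (pinT hHD hI h₁ h₃ h hA (Wg @hGR @η @hη @hηc @τSyl @TSyl @hTSyl) (SInstance.S @hGR @η @hη @hηc @hGR₀ @hGR₁ @hGR₂ @hGR₃ (fun V c k => archLineInputOf (𝔄 V c) k)) μ).GoodCtx ι₁ c)
    (hK : Module.finrank ℚ c.K = 6) :
    Nonempty ((pinT hHD hI h₁ h₃ h hA (Wg @hGR @η @hη @hηc @τSyl @TSyl @hTSyl) (SInstance.S @hGR @η @hη @hηc @hGR₀ @hGR₁ @hGR₂ @hGR₃ (fun V c k => archLineInputOf (𝔄 V c) k)) μ).Real34FunBridge V c) :=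
  real34_totalK @hGR @η @hη @hηc @hGR₀ @hGR₁ @hGR₂ @hGR₃ (fun V c k => archLineInputOf (𝔄 V c) k) hHD hI h₁ h₃ h hA @μ hpc hcup hph h31 hLiu
    (hAw_archLine @hGR @η @hη @hηc @hGR₀ @hGR₁ @hGR₂ @hGR₃ hHD hI h₁ h₃ h hA @μ @𝔄)
    (fun V c hV => hcorr_total @hGR @η @hη @hηc @hGR₀ @hGR₁ @hGR₂ @hGR₃ (fun V c k => archLineInputOf (𝔄 V c) k) hHD hI h₁ h₃ V c hV)
    D V c hc hK

/-- **E's binder `real34` VERBATIM at the pins of record from the K-type datum ALONE** — in E's own `thetaModelOf …` text, at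
`W := Wg …`, `S := SInstance.S … (fun V c k => archLineInputOf (𝔄 V c) k)`; hypotheses = E's own `hpc hcup hph h31 hLiu` (the latter in
E's text) and `D`. -/
theorem real34_totalKAE (hpc : (picardCMUniverse hHD hI h₁ h₃).Fact_pull_comp)
    (hcup : (picardCMUniverse hHD hI h₁ h₃).Fact_pull_cup) (hph : (picardCMUniverse hHD hI h₁ h₃).Fact_pull_hodge)
    (h31 : (picardCMUniverse hHD hI h₁ h₃).Fact_cmInflation)
    (hLiu : ∀ {L : CMField} {ι₁ : L →+* ℂ} (V : HermSpace3 L ι₁) (c : SeesawCtx L),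
      (thetaModelOf hHD hI h₁ h₃ h (embOf hHD hI h₁ h₃) (coverOf hHD hI h₁ h₃ hA) (wmOfInput (Wg @hGR @η @hη @hηc @τSyl @TSyl @hTSyl)) (thetaOf _ (thetaClassInputOf _ (fun V c => thetaSpaceInputOf hHD hI h₁ h₃ (SInstance.S @hGR @η @hη @hηc @hGR₀ @hGR₁ @hGR₂ @hGR₃ (fun V c k => archLineInputOf (𝔄 V c) k)) V c))) (d12Of μ) (d34Of μ)).GoodCtx ι₁ c → Module.finrank ℚ c.K = 6 →
      ∀ (i : Fin 4) (Γ : Level V), ∃ (M : CMField) (k : c.K →+* M) (σ' : M →+* ℂ), σ'.comp k = c.σ ∧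
        (thetaModelOf hHD hI h₁ h₃ h (embOf hHD hI h₁ h₃) (coverOf hHD hI h₁ h₃ hA) (wmOfInput (Wg @hGR @η @hη @hηc @τSyl @TSyl @hTSyl)) (thetaOf _ (thetaClassInputOf _ (fun V c => thetaSpaceInputOf hHD hI h₁ h₃ (SInstance.S @hGR @η @hη @hηc @hGR₀ @hGR₁ @hGR₂ @hGR₃ (fun V c k => archLineInputOf (𝔄 V c) k)) V c))) (d12Of μ) (d34Of μ)).Theta V c i Γ ⊆
          (picardCMUniverse hHD hI h₁ h₃).Uiso Γ M (inflate k (c.Ψ i)) σ')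
    (D : ∀ {L : CMField} {ι₁ : L →+* ℂ} (V : HermSpace3 L ι₁) (c : SeesawCtx L) (hV : IsAnisotropic L V.Hm)
      (hc : (pinT hHD hI h₁ h₃ h hA (Wg @hGR @η @hη @hηc @τSyl @TSyl @hTSyl) (SInstance.S @hGR @η @hη @hηc @hGR₀ @hGR₁ @hGR₂ @hGR₃ (fun V c k => archLineInputOf (𝔄 V c) k)) μ).GoodCtx ι₁ c), Module.finrank ℚ c.K = 6 →
        Real34KTypeDatum hHD hI h₁ h₃ h hA (Wg @hGR @η @hη @hηc @τSyl @TSyl @hTSyl) (SInstance.S @hGR @η @hη @hηc @hGR₀ @hGR₁ @hGR₂ @hGR₃ (fun V c k => archLineInputOf (𝔄 V c) k)) μ V c hV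
          (SeesawHyp34.ofTotal @hGR @η @hη @hηc @hGR₀ @hGR₁ @hGR₂ @hGR₃ (fun V c k => archLineInputOf (𝔄 V c) k) V c
            (planeDefinite_of_goodCtx @hGR @η @hη @hηc @hGR₀ @hGR₁ @hGR₂ @hGR₃ (fun V c k => archLineInputOf (𝔄 V c) k) hHD hI h₁ h₃ h hA @μ c hc))
          (adm₃₄ hHD hI h₁ h₃ ((SInstance.S @hGR @η @hη @hηc @hGR₀ @hGR₁ @hGR₂ @hGR₃ (fun V c k => archLineInputOf (𝔄 V c) k)) V c) hV)) :
    ∀ {L : CMField} {ι₁ : L →+* ℂ} (V : HermSpace3 L ι₁) (c : SeesawCtx L),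
      (thetaModelOf hHD hI h₁ h₃ h (embOf hHD hI h₁ h₃) (coverOf hHD hI h₁ h₃ hA) (wmOfInput (Wg @hGR @η @hη @hηc @τSyl @TSyl @hTSyl))
        (thetaOf _ (thetaClassInputOf _ (fun V c => thetaSpaceInputOf hHD hI h₁ h₃
          (SInstance.S @hGR @η @hη @hηc @hGR₀ @hGR₁ @hGR₂ @hGR₃ (fun V c k => archLineInputOf (𝔄 V c) k)) V c))) (d12Of μ) (d34Of μ)).GoodCtx ι₁ c →
      Module.finrank ℚ c.K = 6 →
      Nonempty ((thetaModelOf hHD hI h₁ h₃ h (embOf hHD hI h₁ h₃) (coverOf hHD hI h₁ h₃ hA) (wmOfInput (Wg @hGR @η @hη @hηc @τSyl @TSyl @hTSyl))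
        (thetaOf _ (thetaClassInputOf _ (fun V c => thetaSpaceInputOf hHD hI h₁ h₃
          (SInstance.S @hGR @η @hη @hηc @hGR₀ @hGR₁ @hGR₂ @hGR₃ (fun V c k => archLineInputOf (𝔄 V c) k)) V c))) (d12Of μ) (d34Of μ)).Real34FunBridge V c) :=
  fun V c hc hK => real34_totalKA @hGR @η @hη @hηc @hGR₀ @hGR₁ @hGR₂ @hGR₃ hHD hI h₁ h₃ h hA @μ @𝔄 hpc hcup hph h31 hLiu D V c hc hK

/-! ## 3. Density-free, character-wise twins -/

/-- **Row 15 (`real34`) at the pins of record from the CHARACTER-WISE K-type datum ALONE** (density-free twin; quantified `pinT` form): #28 `real34_totalKT` at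
`A := fun V c k => archLineInputOf (𝔄 V c) k` with `hAw := hAw_archLine`, `hcorr := hcorr_total`. -/
theorem real34_totalKTA (hpc : (picardCMUniverse hHD hI h₁ h₃).Fact_pull_comp)
    (hcup : (picardCMUniverse hHD hI h₁ h₃).Fact_pull_cup) (hph : (picardCMUniverse hHD hI h₁ h₃).Fact_pull_hodge)
    (h31 : (picardCMUniverse hHD hI h₁ h₃).Fact_cmInflation)
    (hLiu : ∀ {L : CMField} {ι₁ : L →+* ℂ} (V : HermSpace3 L ι₁) (c : SeesawCtx L),
      (pinT hHD hI h₁ h₃ h hA (Wg @hGR @η @hη @hηc @τSyl @TSyl @hTSyl) (SInstance.S @hGR @η @hη @hηc @hGR₀ @hGR₁ @hGR₂ @hGR₃ (fun V c k => archLineInputOf (𝔄 V c) k)) μ).GoodCtx ι₁ c → Module.finrank ℚ c.K = 6 →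
      ∀ (i : Fin 4) (Γ : Level V), ∃ (M : CMField) (k : c.K →+* M) (σ' : M →+* ℂ), σ'.comp k = c.σ ∧
        (pinT hHD hI h₁ h₃ h hA (Wg @hGR @η @hη @hηc @τSyl @TSyl @hTSyl) (SInstance.S @hGR @η @hη @hηc @hGR₀ @hGR₁ @hGR₂ @hGR₃ (fun V c k => archLineInputOf (𝔄 V c) k)) μ).Theta V c i Γ ⊆
          (picardCMUniverse hHD hI h₁ h₃).Uiso Γ M (inflate k (c.Ψ i)) σ')
    (DT : ∀ {L : CMField} {ι₁ : L →+* ℂ} (V : HermSpace3 L ι₁) (c : SeesawCtx L) (hV : IsAnisotropic L V.Hm)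
      (hc : (pinT hHD hI h₁ h₃ h hA (Wg @hGR @η @hη @hηc @τSyl @TSyl @hTSyl) (SInstance.S @hGR @η @hη @hηc @hGR₀ @hGR₁ @hGR₂ @hGR₃ (fun V c k => archLineInputOf (𝔄 V c) k)) μ).GoodCtx ι₁ c), Module.finrank ℚ c.K = 6 →
        Real34KTypeDatumT hHD hI h₁ h₃ h hA (Wg @hGR @η @hη @hηc @τSyl @TSyl @hTSyl) (SInstance.S @hGR @η @hη @hηc @hGR₀ @hGR₁ @hGR₂ @hGR₃ (fun V c k => archLineInputOf (𝔄 V c) k)) μ V c hV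
          (SeesawHyp34.ofTotal @hGR @η @hη @hηc @hGR₀ @hGR₁ @hGR₂ @hGR₃ (fun V c k => archLineInputOf (𝔄 V c) k) V c
            (planeDefinite_of_goodCtx @hGR @η @hη @hηc @hGR₀ @hGR₁ @hGR₂ @hGR₃ (fun V c k => archLineInputOf (𝔄 V c) k) hHD hI h₁ h₃ h hA @μ c hc))
          (adm₃₄ hHD hI h₁ h₃ ((SInstance.S @hGR @η @hη @hηc @hGR₀ @hGR₁ @hGR₂ @hGR₃ (fun V c k => archLineInputOf (𝔄 V c) k)) V c) hV))
    {L : CMField} {ι₁ : L →+* ℂ} (V : HermSpace3 L ι₁) (c : SeesawCtx L)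
    (hc : (pinT hHD hI h₁ h₃ h hA (Wg @hGR @η @hη @hηc @τSyl @TSyl @hTSyl) (SInstance.S @hGR @η @hη @hηc @hGR₀ @hGR₁ @hGR₂ @hGR₃ (fun V c k => archLineInputOf (𝔄 V c) k)) μ).GoodCtx ι₁ c)
    (hK : Module.finrank ℚ c.K = 6) :
    Nonempty ((pinT hHD hI h₁ h₃ h hA (Wg @hGR @η @hη @hηc @τSyl @TSyl @hTSyl) (SInstance.S @hGR @η @hη @hηc @hGR₀ @hGR₁ @hGR₂ @hGR₃ (fun V c k => archLineInputOf (𝔄 V c) k)) μ).Real34FunBridge V c) :=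
  real34_totalKT @hGR @η @hη @hηc @hGR₀ @hGR₁ @hGR₂ @hGR₃ (fun V c k => archLineInputOf (𝔄 V c) k) hHD hI h₁ h₃ h hA @μ hpc hcup hph h31 hLiu
    (hAw_archLine @hGR @η @hη @hηc @hGR₀ @hGR₁ @hGR₂ @hGR₃ hHD hI h₁ h₃ h hA @μ @𝔄)
    (fun V c hV => hcorr_total @hGR @η @hη @hηc @hGR₀ @hGR₁ @hGR₂ @hGR₃ (fun V c k => archLineInputOf (𝔄 V c) k) hHD hI h₁ h₃ V c hV)
    DT V c hc hK

/-- **E's binder `real34` VERBATIM at the pins of record from the CHARACTER-WISE K-type datum ALONE** (density-free twin) — in E's own `thetaModelOf …` text, at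
`W := Wg …`, `S := SInstance.S … (fun V c k => archLineInputOf (𝔄 V c) k)`; hypotheses = E's own `hpc hcup hph h31 hLiu` (the latter in
E's text) and `D`. -/
theorem real34_totalKTAE (hpc : (picardCMUniverse hHD hI h₁ h₃).Fact_pull_comp)
    (hcup : (picardCMUniverse hHD hI h₁ h₃).Fact_pull_cup) (hph : (picardCMUniverse hHD hI h₁ h₃).Fact_pull_hodge)
    (h31 : (picardCMUniverse hHD hI h₁ h₃).Fact_cmInflation)
    (hLiu : ∀ {L : CMField} {ι₁ : L →+* ℂ} (V : HermSpace3 L ι₁) (c : SeesawCtx L),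
      (thetaModelOf hHD hI h₁ h₃ h (embOf hHD hI h₁ h₃) (coverOf hHD hI h₁ h₃ hA) (wmOfInput (Wg @hGR @η @hη @hηc @τSyl @TSyl @hTSyl)) (thetaOf _ (thetaClassInputOf _ (fun V c => thetaSpaceInputOf hHD hI h₁ h₃ (SInstance.S @hGR @η @hη @hηc @hGR₀ @hGR₁ @hGR₂ @hGR₃ (fun V c k => archLineInputOf (𝔄 V c) k)) V c))) (d12Of μ) (d34Of μ)).GoodCtx ι₁ c → Module.finrank ℚ c.K = 6 →
      ∀ (i : Fin 4) (Γ : Level V), ∃ (M : CMField) (k : c.K →+* M) (σ' : M →+* ℂ), σ'.comp k = c.σ ∧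
        (thetaModelOf hHD hI h₁ h₃ h (embOf hHD hI h₁ h₃) (coverOf hHD hI h₁ h₃ hA) (wmOfInput (Wg @hGR @η @hη @hηc @τSyl @TSyl @hTSyl)) (thetaOf _ (thetaClassInputOf _ (fun V c => thetaSpaceInputOf hHD hI h₁ h₃ (SInstance.S @hGR @η @hη @hηc @hGR₀ @hGR₁ @hGR₂ @hGR₃ (fun V c k => archLineInputOf (𝔄 V c) k)) V c))) (d12Of μ) (d34Of μ)).Theta V c i Γ ⊆
          (picardCMUniverse hHD hI h₁ h₃).Uiso Γ M (inflate k (c.Ψ i)) σ')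
    (DT : ∀ {L : CMField} {ι₁ : L →+* ℂ} (V : HermSpace3 L ι₁) (c : SeesawCtx L) (hV : IsAnisotropic L V.Hm)
      (hc : (pinT hHD hI h₁ h₃ h hA (Wg @hGR @η @hη @hηc @τSyl @TSyl @hTSyl) (SInstance.S @hGR @η @hη @hηc @hGR₀ @hGR₁ @hGR₂ @hGR₃ (fun V c k => archLineInputOf (𝔄 V c) k)) μ).GoodCtx ι₁ c), Module.finrank ℚ c.K = 6 →
        Real34KTypeDatumT hHD hI h₁ h₃ h hA (Wg @hGR @η @hη @hηc @τSyl @TSyl @hTSyl) (SInstance.S @hGR @η @hη @hηc @hGR₀ @hGR₁ @hGR₂ @hGR₃ (fun V c k => archLineInputOf (𝔄 V c) k)) μ V c hV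
          (SeesawHyp34.ofTotal @hGR @η @hη @hηc @hGR₀ @hGR₁ @hGR₂ @hGR₃ (fun V c k => archLineInputOf (𝔄 V c) k) V c
            (planeDefinite_of_goodCtx @hGR @η @hη @hηc @hGR₀ @hGR₁ @hGR₂ @hGR₃ (fun V c k => archLineInputOf (𝔄 V c) k) hHD hI h₁ h₃ h hA @μ c hc))
          (adm₃₄ hHD hI h₁ h₃ ((SInstance.S @hGR @η @hη @hηc @hGR₀ @hGR₁ @hGR₂ @hGR₃ (fun V c k => archLineInputOf (𝔄 V c) k)) V c) hV)) :
    ∀ {L : CMField} {ι₁ : L →+* ℂ} (V : HermSpace3 L ι₁) (c : SeesawCtx L),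
      (thetaModelOf hHD hI h₁ h₃ h (embOf hHD hI h₁ h₃) (coverOf hHD hI h₁ h₃ hA) (wmOfInput (Wg @hGR @η @hη @hηc @τSyl @TSyl @hTSyl))
        (thetaOf _ (thetaClassInputOf _ (fun V c => thetaSpaceInputOf hHD hI h₁ h₃
          (SInstance.S @hGR @η @hη @hηc @hGR₀ @hGR₁ @hGR₂ @hGR₃ (fun V c k => archLineInputOf (𝔄 V c) k)) V c))) (d12Of μ) (d34Of μ)).GoodCtx ι₁ c →
      Module.finrank ℚ c.K = 6 →
      Nonempty ((thetaModelOf hHD hI h₁ h₃ h (embOf hHD hI h₁ h₃) (coverOf hHD hI h₁ h₃ hA) (wmOfInput (Wg @hGR @η @hη @hηc @τSyl @TSyl @hTSyl))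
        (thetaOf _ (thetaClassInputOf _ (fun V c => thetaSpaceInputOf hHD hI h₁ h₃
          (SInstance.S @hGR @η @hη @hηc @hGR₀ @hGR₁ @hGR₂ @hGR₃ (fun V c k => archLineInputOf (𝔄 V c) k)) V c))) (d12Of μ) (d34Of μ)).Real34FunBridge V c) :=
  fun V c hc hK => real34_totalKTA @hGR @η @hη @hηc @hGR₀ @hGR₁ @hGR₂ @hGR₃ hHD hI h₁ h₃ h hA @μ @𝔄 hpc hcup hph h31 hLiu DT V c hc hK

end Gen12Pins

end HodgeCM.Model

end
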